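import Literature.Geometry.Symplectic.TaubesFamilyCurvatureIntegral
import Literature.Geometry.GaugeTheory.AdaptedFramesTraceHessian
import HarnessLib

/-!
# `∫_N (Δ_{g_J} f) ω ∧ ω = 0` on a closed symplectic `4`-manifold

Topic `Literature/Geometry/Symplectic`; the integration by parts behind the `L²` bounds of
Taubes 1994, §2 (proof of Lemma 3: "integrating both sides of this last equation over `X` to
obtain the bound on the `L²` norm of `|∇_Aψ|²`"): for a smooth function `f` on the closed
symplectic `4`-manifold `(N, s, J)` with its compatible metric `g_J` and the volume form `s ∧ s`,
the trace of the `g_J`-Hessian in the unitary frames of `𝔰_J` (the negative of the Laplace–Beltrami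
operator, `Δf = -Σ_k Hess f(e_k, e_k)`) integrates to zero:

  `∫_N (Σ_k Hess f(e_k, e_k)) · (s ∧ s) = 0`.

Proof (`GaugeTheory/AdaptedFramesTraceHessian` + Stokes): `Σ_k Hess f(e_k,e_k) = -(dθ(e₀,e₁) + dθ(e₂,e₃))`
for the smooth 1-form `θ = df ∘ J` (the quasi-Kähler cancellation, `ds = 0`), and for any 2-form
`(θ' ∧ s) = ½(θ'(e₀,e₁) + θ'(e₂,e₃))·(s ∧ s)` (`wedge_symplectic_eq_smul_wedge_self`), so the
integrand is `-2 dθ ∧ s = -2 d(θ ∧ s)`, exact.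

* `traceHessian h hs hnd f x = Σ_k Hess_{g_J} f(e_k, e_k)(x)` in the unitary frame of the chart at `x`;
* `integral_mextDeriv_toMForm_wedge_eq_zero`: `∫ dθ ∧ s = 0` for every smooth real 1-form `θ`;
* **`integral_traceHessian_smul_wedge_self_eq_zero`**: `∫ (Σ_k Hess f(e_k,e_k)) (s ∧ s) = 0`.

PROVED, 0 named facts.

## References

* C. H. Taubes, *The Seiberg–Witten invariants and symplectic forms*, Math. Res. Lett. 1 (1994)
  809–822, §2 (proof of Lemma 3, p. 814). [Taubes1994]
* F. W. Warner, *Foundations of Differentiable Manifolds and Lie Groups*, GTM 94 (1983), 4.9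
  (Stokes), 6.1–6.2. [WarnerGTM94]
-/

noncomputable section

open scoped Manifold ContDiff Topology
open Set Function Complex Literature.Geometry.Kaehler Literature.Geometry.GaugeTheory Literature.Topology.FourManifolds
open Literature.Geometry.Lorentzian (PseudoRiemannianMetric)
open Literature.Geometry.Manifold Literature.Geometry.Manifold.DeRhamSignFour Literature.NumberTheory.Transcendental

namespace Literature.Geometry.Symplectic

namespace AlmostComplexStructure.IsCompatibleWith

variable {N : Type} [TopologicalSpace N] [ChartedSpace (EuclideanSpace ℝ (Fin 4)) N] [IsManifold (𝓡 4) ∞ N]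
  {J : AlmostComplexStructure (𝓡 4) ∞ N} {s : MForm (𝓡 4) N ℝ 2}
  (h : J.IsCompatibleWith s) (hs : IsSmoothForm s)
  (hnd : ∀ x (v : TangentSpace (𝓡 4) x), v ≠ 0 → ∃ w : TangentSpace (𝓡 4) x, s x ![v, w] ≠ 0)

/-- **The trace of the `g_J`-Hessian of `f` at `x`**, `Σ_k Hess f(e_k, e_k)(x) = Σ_k (e_k(e_k f) - (∇_{e_k}e_k)f)(x)`,
in the unitary frame of the chart of `𝔰_J` at `x` (`= -Δ_{g_J} f (x)`, the chart choice being immaterial).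
[cite: WarnerGTM94, 6.1] -/
def traceHessian [(h.metric hs).HasLeviCivita] (f : N → ℝ) (x : N) : ℝ :=
  ∑ k, (h.metric hs).hessianAux f
    ((h.canonicalSpincStructure hs hnd).frame ((h.canonicalSpincStructure hs hnd).indexAt x) k)
    ((h.canonicalSpincStructure hs hnd).frame ((h.canonicalSpincStructure hs hnd).indexAt x) k) x

/-- Unfolding `traceHessian`. [folklore] -/
theorem traceHessian_apply [(h.metric hs).HasLeviCivita] (f : N → ℝ) (x : N) :
    h.traceHessian hs hnd f x = ∑ k, (h.metric hs).hessianAux f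
      ((h.canonicalSpincStructure hs hnd).frame ((h.canonicalSpincStructure hs hnd).indexAt x) k)
      ((h.canonicalSpincStructure hs hnd).frame ((h.canonicalSpincStructure hs hnd).indexAt x) k) x :=
  rfl

include hs in
omit [IsManifold (𝓡 4) ∞ N] in
/-- **`dθ ∧ s` is exact** (degree `4`, after the cast `2 + 2 = 4`) for a smooth real 1-form `θ` and the
closed symplectic form `s`. [cite: WarnerGTM94, 2.21, 4.9] -/
theorem mextDeriv_toMForm_wedge_mem_exactSmoothForms (hcl : IsClosedForm s) {θ : RealOneForm N}
    (hθ : IsSmoothForm θ.toMForm) :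
    ((mextDeriv θ.toMForm).wedge s).castDeg two_add_two_eq_four ∈ exactSmoothForms (𝓡 4) N ℝ 4 := by
  haveI := wedgeFacts_four (N := N)
  refine castDeg_mem_exactSmoothForms two_add_two_eq_four (wedge_mem_exactSmoothForms_of_left ?_ ⟨hs, hcl⟩)
  change mextDeriv θ.toMForm ∈ Submodule.span ℝ (mextDeriv '' (smoothForms (𝓡 4) N ℝ 1 : Set (MForm (𝓡 4) N ℝ 1)))
  exact Submodule.subset_span ⟨_, hθ, rfl⟩

include hs in
/-- **`∫_N dθ ∧ s = 0`** on the closed symplectic `4`-manifold, for every smooth real 1-form `θ` (Stokes;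
orientation of the volume form `s ∧ s`). [cite: WarnerGTM94, 4.9] -/
theorem integral_mextDeriv_toMForm_wedge_eq_zero [T2Space N] [CompactSpace N] (hcl : IsClosedForm s)
    {θ : RealOneForm N} (hθ : IsSmoothForm θ.toMForm) :
    MForm.integral (rayFamily (wedge_self_castDeg_apply_ne_zero s hnd))
      (((mextDeriv θ.toMForm).wedge s).castDeg two_add_two_eq_four) = 0 :=
  MForm.integral_eq_zero_of_mem_exactSmoothForms_holds _
    (isContinuousOrientation_rayFamily (wedge_self_castDeg_mem_closedSmoothForms ⟨hs, hcl⟩).1 _)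
    (mextDeriv_toMForm_wedge_mem_exactSmoothForms hs hcl hθ)

/-- **The trace of the Hessian is the `ω`-component of `d(df ∘ J)`** on `(N, s, J)` with `ds = 0`, in the
unitary frame of the chart at `x`: `d(df∘J)(e₀,e₁) + d(df∘J)(e₂,e₃) = -Σ_k Hess f(e_k,e_k)`
(`AdaptedFrames.mextDeriv_jGradForm_frame_sum`). [cite: Taubes1994, §2 (proof of Lemma 3)] -/
theorem mextDeriv_jGradForm_frame_sum_eq [(h.metric hs).HasLeviCivita] (hcl : IsClosedForm s)
    {f : N → ℝ} (hf : ContMDiff (𝓡 4) 𝓘(ℝ, ℝ) ∞ f) (x : N) :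
    mextDeriv (jGradForm J f).toMForm x
        ![(h.canonicalSpincStructure hs hnd).frame ((h.canonicalSpincStructure hs hnd).indexAt x) 0 x,
          (h.canonicalSpincStructure hs hnd).frame ((h.canonicalSpincStructure hs hnd).indexAt x) 1 x] +
      mextDeriv (jGradForm J f).toMForm x
        ![(h.canonicalSpincStructure hs hnd).frame ((h.canonicalSpincStructure hs hnd).indexAt x) 2 x,
          (h.canonicalSpincStructure hs hnd).frame ((h.canonicalSpincStructure hs hnd).indexAt x) 3 x] =
      -h.traceHessian hs hnd f x :=
  (h.unitaryAdaptedFrames hs hnd).mextDeriv_jGradForm_frame_sum ((h.canonicalSpincStructure hs hnd).indexAt x)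
    ((h.canonicalSpincStructure hs hnd).mem_baseSet_indexAt x) s hs hcl (fun y _ v w ↦ h.form_eq_metric_val_map hs y v w) hf

/-- **`∫_N (Σ_k Hess f(e_k, e_k)) (s ∧ s) = 0`** — equivalently `∫_N (Δ_{g_J} f) dvol = 0` — for a smooth
function `f` on the closed symplectic `4`-manifold `(N, s, J)`: the integrand is `-2 d(df∘J) ∧ s`, exact.
This is the integration by parts used on the Bochner–Weitzenböck identities in the proof of Taubes's
Lemma 3. [cite: Taubes1994, §2 (proof of Lemma 3, p. 814)] -/
theorem integral_traceHessian_smul_wedge_self_eq_zero [T2Space N] [CompactSpace N] [(h.metric hs).HasLeviCivita]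
    (hcl : IsClosedForm s) {f : N → ℝ} (hf : ContMDiff (𝓡 4) 𝓘(ℝ, ℝ) ∞ f) :
    MForm.integral (rayFamily (wedge_self_castDeg_apply_ne_zero s hnd))
      ((h.traceHessian hs hnd f) • (s.wedge s).castDeg two_add_two_eq_four) = 0 := by
  have hint := integral_mextDeriv_toMForm_wedge_eq_zero hs hnd hcl (isSmoothForm_toMForm_jGradForm J hf)
  have hθ := h.wedge_symplectic_eq_smul_wedge_self hs hnd (mextDeriv (jGradForm J f).toMForm)
  have hcoef : (fun x ↦ (mextDeriv (jGradForm J f).toMForm x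
        ![(h.canonicalSpincStructure hs hnd).frame ((h.canonicalSpincStructure hs hnd).indexAt x) 0 x,
          (h.canonicalSpincStructure hs hnd).frame ((h.canonicalSpincStructure hs hnd).indexAt x) 1 x] +
      mextDeriv (jGradForm J f).toMForm x
        ![(h.canonicalSpincStructure hs hnd).frame ((h.canonicalSpincStructure hs hnd).indexAt x) 2 x,
          (h.canonicalSpincStructure hs hnd).frame ((h.canonicalSpincStructure hs hnd).indexAt x) 3 x]) / 2) =
      fun x ↦ (-2⁻¹ : ℝ) * h.traceHessian hs hnd f x := by
    funext x
    rw [h.mextDeriv_jGradForm_frame_sum_eq hs hnd hcl hf x]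
    ring
  rw [hθ, hcoef] at hint
  have hsmul : ((fun x ↦ (-2⁻¹ : ℝ) * h.traceHessian hs hnd f x) • s.wedge s).castDeg two_add_two_eq_four =
      (-2⁻¹ : ℝ) • ((h.traceHessian hs hnd f) • (s.wedge s).castDeg two_add_two_eq_four) := by
    funext x
    ext w
    simp [mul_assoc]
  rw [hsmul, MForm.integral_smul] at hint
  simpa using hint

end AlmostComplexStructure.IsCompatibleWith

end Literature.Geometry.Symplectic

end
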